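import Summits.HodgeConjecture.HodgeCM.PerL34.SmallLevelTorsionFree_1

/-! PORT of `HodgeCM/PerL34/SmallLevelTorsionFree.lean` (HodgeCMPerL run 82) — part 2: continuation of `Summits.HodgeConjecture.HodgeCM.PerL34.SmallLevelTorsionFree_1` (split at a top-level declaration boundary by port_pkg.py; scope re-opened below; declarations unchanged). -/

-- port_pkg: scope re-opened for this part (file-level context, then the namespace/section stack open at the cut)
set_option autoImplicit false
noncomputable section
open scoped Pointwise MatrixGroups RestrictedProduct Matrix NumberField
open NumberField IsDedekindDomain Topology
open HodgeCM.Adelic HodgeCM.PerL34.AdelicUnitaryFactorisation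
namespace HodgeCM.PerL34.Godement
section Global
variable (L : CMField) {m : ℕ}
local notation "𝔸f" => FiniteAdeleRing (𝓞 L) L
/-- `GL_m(L) → GL_m(𝔸_{L,f}) → GL_m(L_v)` is the entrywise embedding `L → L_v`. -/
theorem val_evalPlaceGL_toFinGL (v : HeightOneSpectrum (𝓞 L)) (g : GL (Fin m) L) :
    ((evalPlaceGL L v (toFinGL L g) : GL (Fin m) (v.adicCompletion L)) :
        Matrix (Fin m) (Fin m) (v.adicCompletion L)) =
      (g : Matrix (Fin m) (Fin m) L).map (algebraMap (L : Type) (v.adicCompletion L)) := by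
  rw [val_evalPlaceGL, val_toFinGL, Matrix.map_map]
  rfl

/-- (Ported verbatim from the HodgeCMPerL package; no docstring in the source.) -/
theorem evalPlaceGL_toFinGL_injective (v : HeightOneSpectrum (𝓞 L)) :
    Function.Injective (fun g : GL (Fin m) L => evalPlaceGL L v (toFinGL L g)) := by
  intro g h hgh
  have hmat := congrArg (fun u : GL (Fin m) (v.adicCompletion L) =>
    (u : Matrix (Fin m) (Fin m) (v.adicCompletion L))) hgh
  simp only [val_evalPlaceGL_toFinGL] at hmat
  exact Units.ext (Matrix.map_injective (algebraMap (L : Type) (v.adicCompletion L)).injective hmat)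

variable {L}

/-- Entries of `k − 1` for `k ∈ K(n)` have `|·|_v ≤ |n|_v` at every finite place `v` (`n ≠ 0`). -/
theorem valued_sub_one_le_of_mem_finLevel {n : ℕ} (hn : n ≠ 0) (v : HeightOneSpectrum (𝓞 L))
    {k : GL (Fin m) 𝔸f} (hk : k ∈ finLevel L m n) (i j : Fin m) :
    Valued.v (evalPlace L v (((k : Matrix (Fin m) (Fin m) 𝔸f) - 1) i j)) ≤
      Valued.v ((n : ℕ) : v.adicCompletion L) := by
  have hx := ((mem_finLevel_iff m).mp hk).1.2 i j
  set x : 𝔸f := ((k : Matrix (Fin m) (Fin m) 𝔸f) - 1) i j with hxdef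
  have hns : (n : 𝔸f) * levelScalar L n = 1 := by
    rw [levelScalar, ← map_natCast (algebraMap (L : Type) 𝔸f) n, ← map_mul,
      mul_inv_cancel₀ (Nat.cast_ne_zero.mpr hn), map_one]
  have hxn : x = (n : 𝔸f) * (levelScalar L n * x) := by rw [← mul_assoc, hns, one_mul]
  rw [hxn, map_mul, map_natCast, map_mul]
  exact mul_le_of_le_one_right' (valued_evalPlace_le_one v hx)

/-- **Minkowski–Serre for `K(n)`, `n ≥ 3` (KERNEL).**  If `g₀ ∈ GL_m(L)` has prime-power-one `g₀ ^ p = 1` and some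
`GL_m(𝔸_{L,f})`-conjugate of its diagonal image lies in the principal congruence subgroup `K(n)`, `n ≥ 3`, then
`g₀ = 1`. -/
theorem eq_one_of_pow_prime_eq_one_of_conj_mem_finLevel {n : ℕ} (hn : 3 ≤ n) {p : ℕ} (hp : p.Prime)
    {g₀ : GL (Fin m) L} (hpow : g₀ ^ p = 1) (g : GL (Fin m) 𝔸f)
    (hmem : g⁻¹ * toFinGL L g₀ * g ∈ finLevel L m n) : g₀ = 1 := by
  obtain ⟨v, q₀, hq₀n, hq₀1, hgood⟩ := exists_place_modulus L hn
  -- notation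
  set w : Valuation (v.adicCompletion L) (WithZero (Multiplicative ℤ)) := Valued.v with hw
  set u : GL (Fin m) 𝔸f := g⁻¹ * toFinGL L g₀ * g with hu
  set κ : GL (Fin m) (v.adicCompletion L) := evalPlaceGL L v u with hκ
  -- `u ^ p = 1`, hence `κ ^ p = 1`
  have hup : u ^ p = 1 := by
    have hu' : u = MulAut.conj g⁻¹ (toFinGL L g₀) := by rw [MulAut.conj_apply, inv_inv]
    rw [hu', ← map_pow, ← map_pow, hpow, map_one, map_one]
  have hκp : (κ : Matrix (Fin m) (Fin m) (v.adicCompletion L)) ^ p = 1 := by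
    rw [← Units.val_pow_eq_pow_val, hκ, ← map_pow, hup, map_one, Units.val_one]
  -- entries of `κ - 1`
  have hκq : EntryLE w ((κ : Matrix (Fin m) (Fin m) (v.adicCompletion L)) - 1)
      (w ((q₀ : ℕ) : v.adicCompletion L)) := by
    intro i j
    have hsub : (κ : Matrix (Fin m) (Fin m) (v.adicCompletion L)) - 1 =
        (((u : Matrix (Fin m) (Fin m) 𝔸f) - 1)).map (evalPlace L v) := by
      rw [hκ, val_evalPlaceGL, Matrix.map_sub _ (map_sub (evalPlace L v)),
        Matrix.map_one _ (map_zero _) (map_one _)]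
    rw [hsub, Matrix.map_apply]
    refine (valued_sub_one_le_of_mem_finLevel (by omega) v hmem i j).trans ?_
    obtain ⟨t, ht⟩ := hq₀n
    rw [ht, Nat.cast_mul, map_mul]
    exact mul_le_of_le_one_right' (valued_natCast_le_one v t)
  -- the local lemma
  have hκ1 : (κ : Matrix (Fin m) (Fin m) (v.adicCompletion L)) = 1 :=
    eq_one_of_pow_prime_eq_one_of_entryLE (v := w) (valued_natCast_le_one v) hp
      (valued_natCast_ne_zero v hp.ne_zero) hq₀1 (hgood p hp) hκq hκp
  have hκ1' : κ = 1 := Units.val_eq_one.mp hκ1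
  -- undo the conjugation and descend to `L`
  have hT : evalPlaceGL L v (toFinGL L g₀) = 1 := by
    have : toFinGL L g₀ = g * u * g⁻¹ := by rw [hu]; group
    rw [this, map_mul, map_mul, ← hκ, hκ1', mul_one, map_inv, mul_inv_cancel]
  exact evalPlaceGL_toFinGL_injective L v (by simpa only [map_one] using hT)

end Global

/-! ## §5 Headline: `Γ_H(g K_f g⁻¹)` is torsion-free for `K_f ⊆ K_H(n)`, `n ≥ 3` -/

section Headline

variable (L : CMField) {m : ℕ} (H : Matrix (Fin m) (Fin m) L)

local notation "𝔸f" => FiniteAdeleRing (𝓞 L) L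

variable {H} in
/-- Prime-order form: for `K_f ≤ K_H(n)` (`n ≥ 3`), `g ∈ U(H)(𝔸_{L₀,f})`, an element of `Γ_H(g K_f g⁻¹)` with
`γ ^ p = 1` (`p` prime) is trivial. -/
theorem eq_one_of_pow_prime_eq_one_of_mem_congruenceLattice {n : ℕ} (hn : 3 ≤ n)
    {Kf : Subgroup (Ufin L H)} (hK : Kf ≤ levelUfin L H n) (g : Ufin L H) {p : ℕ} (hp : p.Prime)
    {γ : Uinf L H} (hγ : γ ∈ congruenceLattice L H (MulAut.conj g • Kf)) (hγp : γ ^ p = 1) : γ = 1 := by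
  obtain ⟨a, ha, haK, haγ⟩ := (mem_congruenceLattice_iff L H _ γ).mp hγ
  obtain ⟨g₀, hg₀U, hg₀⟩ := (mem_adelicUnitaryRat_iff L H a).1 ha
  have ha' : a = ⟨toAdeleGL L g₀, toAdeleGL_mem L H hg₀U⟩ := Subtype.ext hg₀.symm
  subst ha'
  -- `g₀ ^ p = 1` because `GL_m(L) → GL_m(L_∞)` is injective
  have hpow : g₀ ^ p = 1 := by
    apply toInfGL_injective L (m := m)
    rw [map_pow, map_one, ← coe_splitEquiv_fst_toAdeleGL L H g₀ (toAdeleGL_mem L H hg₀U), haγ,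
      ← Subgroup.coe_pow, hγp, Subgroup.coe_one]
  -- the finite part: `g⁻¹ (g₀)_f g ∈ K_f ≤ K_H(n)`
  have hfin : g⁻¹ * (splitEquiv L H ⟨toAdeleGL L g₀, toAdeleGL_mem L H hg₀U⟩).2 * g ∈ Kf := by
    have := Subgroup.mem_pointwise_smul_iff_inv_smul_mem.mp haK
    rwa [MulAut.smul_def, MulAut.conj_inv_apply] at this
  have hlev : ((g⁻¹ * (splitEquiv L H ⟨toAdeleGL L g₀, toAdeleGL_mem L H hg₀U⟩).2 * g : Ufin L H) :
      GL (Fin m) 𝔸f) ∈ finLevel L m n := mem_levelUfin_iff.mp (hK hfin)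
  rw [Subgroup.coe_mul, Subgroup.coe_mul, Subgroup.coe_inv, coe_splitEquiv_snd_toAdeleGL] at hlev
  have hg₀1 : g₀ = 1 := eq_one_of_pow_prime_eq_one_of_conj_mem_finLevel hn hp hpow _ hlev
  subst hg₀1
  apply Subtype.ext
  rw [← haγ, coe_splitEquiv_fst_toAdeleGL, map_one, Subgroup.coe_one]

variable {H} in
/-- **PerL v5 ll. 72–75, group level (KERNEL, Minkowski–Serre): small congruence levels give TORSION-FREE
lattices.**  For `n ≥ 3`, every `K_f ≤ K_H(n)` and every `g ∈ U(H)(𝔸_{L₀,f})`, the lattice `Γ_H(g K_f g⁻¹) ≤ U(H)_∞`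
(row #4's `congruenceLattice`; these are the `Γ_j` of the decomposition `S(K_f) = ⨆_j Γ_j \ X`, row #7) is
torsion-free — the shape of `HodgeCM.Level.torsionFree`. -/
theorem torsionFree_congruenceLattice_conj {n : ℕ} (hn : 3 ≤ n) {Kf : Subgroup (Ufin L H)}
    (hK : Kf ≤ levelUfin L H n) (g : Ufin L H) :
    ∀ γ ∈ congruenceLattice L H (MulAut.conj g • Kf), IsOfFinOrder γ → γ = 1 := by
  intro γ hγ hfin
  by_contra hne
  have hN0 : orderOf γ ≠ 0 := (hfin.orderOf_pos).ne'
  have hN1 : orderOf γ ≠ 1 := fun h => hne (orderOf_eq_one_iff.mp h)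
  set p := (orderOf γ).minFac with hpdef
  have hp : p.Prime := Nat.minFac_prime hN1
  have hdvd : p ∣ orderOf γ := Nat.minFac_dvd _
  have hord : orderOf (γ ^ (orderOf γ / p)) = p := orderOf_pow_orderOf_div hN0 hdvd
  have h1 : γ ^ (orderOf γ / p) = 1 :=
    eq_one_of_pow_prime_eq_one_of_mem_congruenceLattice L hn hK g hp (Subgroup.pow_mem _ hγ _)
      (by have h := pow_orderOf_eq_one (γ ^ (orderOf γ / p)); rwa [hord] at h)
  rw [h1, orderOf_one] at hord
  exact hp.one_lt.ne hord

variable {H} in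
/-- The case `g = 1`: `Γ_H(K_f)` itself is torsion-free for `K_f ≤ K_H(n)`, `n ≥ 3`. -/
theorem torsionFree_congruenceLattice {n : ℕ} (hn : 3 ≤ n) {Kf : Subgroup (Ufin L H)}
    (hK : Kf ≤ levelUfin L H n) :
    ∀ γ ∈ congruenceLattice L H Kf, IsOfFinOrder γ → γ = 1 := by
  have h := torsionFree_congruenceLattice_conj L hn hK 1
  rwa [map_one, one_smul] at h

/-- In particular the principal congruence lattice `Γ_H(K_H(n))`, `n ≥ 3`, is torsion-free. -/
theorem torsionFree_congruenceLattice_levelUfin {n : ℕ} (hn : 3 ≤ n) :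
    ∀ γ ∈ congruenceLattice L H (levelUfin L H n), IsOfFinOrder γ → γ = 1 :=
  torsionFree_congruenceLattice L hn le_rfl

/-- (Ported verbatim from the HodgeCMPerL package; no docstring in the source.) -/
private theorem isCompact_conj_smul' {B : Type*} [Group B] [TopologicalSpace B] [IsTopologicalGroup B]
    (K : Subgroup B) (hK : IsCompact (K : Set B)) (b : B) :
    IsCompact ((MulAut.conj b • K : Subgroup B) : Set B) := by
  have hset : ((MulAut.conj b • K : Subgroup B) : Set B) = (fun x => b * x * b⁻¹) '' (K : Set B) := by
    rw [Subgroup.coe_pointwise_smul, ← Set.image_smul]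
    simp only [MulAut.smul_def, MulAut.conj_apply]
  rw [hset]
  exact hK.image ((continuous_const.mul continuous_id).mul continuous_const)

variable {H} in
/-- **PerL v5 ll. 72–75 (KERNEL): for `K_f ⊆ K_H(n)` compact, `n ≥ 3`, every `Γ_j = Γ_H(g K_f g⁻¹)` acts FREELY on
`U(H)_∞ / C`** for every compact subgroup `C` (e.g. `C = K_∞`, `U(H)_∞/K_∞ = 𝔹² × pt` in signature `(2,1)`):
all isotropy groups are trivial (row #5 `stabilizer_inf_eq_bot_of_torsionFree` + the torsion-freeness above). -/
theorem stabilizer_congruenceLattice_conj_eq_bot {n : ℕ} (hn : 3 ≤ n) {Kf : Subgroup (Ufin L H)}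
    (hK : Kf ≤ levelUfin L H n) (hKc : IsCompact (Kf : Set (Ufin L H))) (g : Ufin L H)
    (C : Subgroup (Uinf L H)) (hC : IsCompact (C : Set (Uinf L H))) (x : Uinf L H ⧸ C) :
    MulAction.stabilizer (Uinf L H) x ⊓ congruenceLattice L H (MulAut.conj g • Kf) = ⊥ := by
  haveI := discreteTopology_congruenceLattice L H (MulAut.conj g • Kf) (isCompact_conj_smul' Kf hKc g)
  exact stabilizer_inf_eq_bot_of_torsionFree _ (torsionFree_congruenceLattice_conj L hn hK g) C hC x

end Headline

/-! ## §6 Hermitian 3-spaces: the pieces of `S(K_f)` for `K_f ⊆ K_H(n)`, `n ≥ 3` -/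

section HermSpace3

variable (L : CMField) {ι₁ : L →+* ℂ} (V : HermSpace3 L ι₁)

/-- For a hermitian 3-space `V` and a level `K_f ≤ K_H(n)` (`n ≥ 3`), every lattice `Γ_H(g K_f g⁻¹) ≤ G_U(ℝ)`
is torsion-free. -/
theorem _root_.HodgeCM.HermSpace3.torsionFree_congruenceLattice_conj {n : ℕ} (hn : 3 ≤ n)
    {Kf : Subgroup (Ufin L V.Hm)} (hK : Kf ≤ levelUfin L V.Hm n) (g : Ufin L V.Hm) :
    ∀ γ ∈ congruenceLattice L V.Hm (MulAut.conj g • Kf), IsOfFinOrder γ → γ = 1 :=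
  HodgeCM.PerL34.Godement.torsionFree_congruenceLattice_conj L hn hK g

/-- … and acts freely on `G_U(ℝ)/C` for every compact `C ≤ G_U(ℝ)` when `K_f` is moreover compact. -/
theorem _root_.HodgeCM.HermSpace3.stabilizer_congruenceLattice_conj_eq_bot {n : ℕ} (hn : 3 ≤ n)
    {Kf : Subgroup (Ufin L V.Hm)} (hK : Kf ≤ levelUfin L V.Hm n) (hKc : IsCompact (Kf : Set (Ufin L V.Hm)))
    (g : Ufin L V.Hm) (C : Subgroup (Uinf L V.Hm)) (hC : IsCompact (C : Set (Uinf L V.Hm)))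
    (x : Uinf L V.Hm ⧸ C) :
    MulAction.stabilizer (Uinf L V.Hm) x ⊓ congruenceLattice L V.Hm (MulAut.conj g • Kf) = ⊥ :=
  HodgeCM.PerL34.Godement.stabilizer_congruenceLattice_conj_eq_bot L hn hK hKc g C hC x

end HermSpace3

/-! ## §7 Cofinality (PerL v5 ll. 74–75): every compact open `K_f` contains an open normal subgroup of finite
index inside `K_H(n)` -/

section Cofinal

variable (L : CMField) {m : ℕ} (H : Matrix (Fin m) (Fin m) L)

/-- **PerL v5 ll. 74–75 (KERNEL): "there is a neat normal `K_1 ⊂ K_f` of finite index."**  For every compact open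
`K_f ≤ U(H)(𝔸_{L₀,f})` and every `n`, there is a compact open subgroup `K₁ ≤ K_f ∩ K_H(n)` which is NORMAL and of
FINITE INDEX in `K_f` (the normal core of `K_f ∩ K_H(n)` in the compact group `K_f`).  With `n ≥ 3`, all lattices
`Γ_H(g K₁ g⁻¹)` are torsion-free by `torsionFree_congruenceLattice_conj`. -/
theorem exists_normal_finiteIndex_le_levelUfin (Kf : Subgroup (Ufin L H)) (hKo : IsOpen (Kf : Set (Ufin L H)))
    (hKc : IsCompact (Kf : Set (Ufin L H))) (n : ℕ) :
    ∃ K₁ : Subgroup (Ufin L H), K₁ ≤ Kf ∧ K₁ ≤ levelUfin L H n ∧ IsOpen (K₁ : Set (Ufin L H)) ∧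
      IsCompact (K₁ : Set (Ufin L H)) ∧ (K₁.subgroupOf Kf).Normal ∧ (K₁.subgroupOf Kf).FiniteIndex := by
  haveI : CompactSpace Kf := isCompact_iff_compactSpace.mp hKc
  set K₀ : Subgroup Kf := (levelUfin L H n).subgroupOf Kf with hK₀
  have hK₀o : IsOpen (K₀ : Set Kf) := (isOpen_levelUfin L H n).preimage continuous_subtype_val
  haveI : Finite (Kf ⧸ K₀) := Subgroup.quotient_finite_of_isOpen K₀ hK₀o
  haveI : K₀.FiniteIndex := Subgroup.finiteIndex_of_finite_quotient
  set N : Subgroup Kf := K₀.normalCore with hN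
  have hNo : IsOpen (N : Set Kf) :=
    Subgroup.isOpen_of_isClosed_of_finiteIndex N (K₀.normalCore_isClosed (K₀.isClosed_of_isOpen hK₀o))
  have hNc : IsCompact (N : Set Kf) := (N.isClosed_of_isOpen hNo).isCompact
  have hsub : (N.map Kf.subtype).subgroupOf Kf = N :=
    Subgroup.comap_map_eq_self_of_injective Kf.subtype_injective N
  refine ⟨N.map Kf.subtype, Subgroup.map_subtype_le N, ?_, ?_, ?_, ?_, ?_⟩
  · rintro x ⟨y, hy, rfl⟩
    exact Subgroup.mem_subgroupOf.mp (K₀.normalCore_le hy)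
  · rw [Subgroup.coe_map]
    exact hKo.isOpenEmbedding_subtypeVal.isOpenMap _ hNo
  · rw [Subgroup.coe_map]
    exact hNc.image continuous_subtype_val
  · rw [hsub]
    infer_instance
  · rw [hsub]
    infer_instance

end Cofinal

end HodgeCM.PerL34.Godement

end

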